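import Summits.Ventures.PackingBounds.ThreePointCert.K6d10Cert

/-!
# κ(6) ≤ 78: kernel validation of Gram block R4 (chunks 1–5 of 8)

Framing: lottery ticket; floor = certified bounds/negative ranges. Venture `PackingBounds` (cell
`pub-packcert`), three-point SDP family. Integer data of a feasible point of the Bachoc–Vallentin
semidefinite program (n = 6, s = 1/2, degree d = 10, symmetric
sums of squares), derived by `pub-packcert-lp/code/lean3pt/cert2lean_lp.py` (the lp seat's fixed-point
variant of `pub-packcert-sdp/code/lean3pt/cert2lean.py`) from the exact rational certificate
`sdp-d6-deg10-sym-lp-v1.json` of the cell (exact verifier #1 + verifier #2 of the other seat), in the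
units of the kernel checker `ThreePointCert.Check` (soundness `ThreePointCert.Sound`). Generated
file: plain lists of integers / monomials.
-/

namespace Summit.Ventures.PackingBounds.ThreePointCert.K6d10

open Literature.Geometry.DiscreteGeometry Literature.Geometry.DiscreteGeometry.PolyCert PolyCert.SPoly

set_option maxHeartbeats 0 in
/-- Block `R4`: rows from 0 (51 rows) of `zᵀ(LLᵀ)z` added to `[]` give `dR4c1` (kernel). -/
theorem okR4_1 : chunkOK K6d10.gR4 0 51 [] K6d10.dR4c1 = true := by
  decide +kernel

set_option maxHeartbeats 0 in
/-- Block `R4`: rows from 51 (23 rows) of `zᵀ(LLᵀ)z` added to `dR4c1` give `dR4c2` (kernel). -/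
theorem okR4_2 : chunkOK K6d10.gR4 51 23 K6d10.dR4c1 K6d10.dR4c2 = true := by
  decide +kernel

set_option maxHeartbeats 0 in
/-- Block `R4`: rows from 74 (19 rows) of `zᵀ(LLᵀ)z` added to `dR4c2` give `dR4c3` (kernel). -/
theorem okR4_3 : chunkOK K6d10.gR4 74 19 K6d10.dR4c2 K6d10.dR4c3 = true := by
  decide +kernel

set_option maxHeartbeats 0 in
/-- Block `R4`: rows from 93 (17 rows) of `zᵀ(LLᵀ)z` added to `dR4c3` give `dR4c4` (kernel). -/
theorem okR4_4 : chunkOK K6d10.gR4 93 17 K6d10.dR4c3 K6d10.dR4c4 = true := by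
  decide +kernel

set_option maxHeartbeats 0 in
/-- Block `R4`: rows from 110 (15 rows) of `zᵀ(LLᵀ)z` added to `dR4c4` give `dR4c5` (kernel). -/
theorem okR4_5 : chunkOK K6d10.gR4 110 15 K6d10.dR4c4 K6d10.dR4c5 = true := by
  decide +kernel

end Summit.Ventures.PackingBounds.ThreePointCert.K6d10
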